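import Summits.CriticalPhenomena.PercolationContinuityZ3.Theorems.Transplant.FKConnectivityAllQAntipodalRootFormRealAttach
import Summits.CriticalPhenomena.PercolationContinuityZ3.Theorems.Transplant.FKConnectivityAllQAntipodalRootFormBaseParMain

/-!
# Connectivity correlation inequalities for `φ_{w,q}`, every `q > 0` — ROOT-FORM CALCULUS, file 61y: the REAL SERIES PAIR `B_y · B_z`
# (Δ-side base: (B2)/(B3) for real boxes)

Support file (`--supports stmt-CriticalPhenomena-4575`), FK sub-lane `prim-bschramm-fk-2` (gen 29); builds on p205010 (kernel theorem,
internal audit signed; external expert review pending).  No definitions, no named facts, no sorries; standard axioms.  Memo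
FROM-fk-2-g28-ROOT-FORM.md §4, §6 ((B2), (B3)); FK-Q2 §38.

* `realBox_A2` — the remaining single-box generator A2 (pivot at the special, virtual root DELETED: `Σ h·([L⁰ ≤ K] − [L¹ ≤ K]) ≥ 0`) for real
  boxes, from `FK.theta_U_pivot` on the apex host (the apex path deleted);
* `combS_realSDat` — series gluing of two one-special boxes at the level of data (`FK.apExpC_series`, `FK.reachable_union_series`);
* `realSerPairEnv_facts` — the five facts for the real environment of `B_y · B_z` (`B_y` TTSP between `a, m` with `y`, `B_z` TTSP between `m, b`
  with `z`): facts 1, 2 from the kernel-checked (B2)/(B3) certificates (`BaseSer.serPair_Mt_nonneg`, `BasePar.serPair_parE_Mt_nonneg`, files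
  61f–61j) transferred along `(β_y, β_z) ↦ β_y ∪ β_z`, facts 3–5 from file 61p.
[cite: Grimmett2006, §1.4 eq. (1.20) (p. 15); §3.8 Thm. (3.90) (pp. 61–62)] [cite: Wagner2006, Thm. 5.8(d), §5.3]
-/

noncomputable section

namespace Summit.CriticalPhenomena.PercolationContinuityZ3.Theorems

namespace FK

namespace RootForm

open SimpleGraph Finset Literature.Probability.LatticeModels Literature.Probability.Percolation
open scoped Classical

variable {V : Type*} [Fintype V]

section A2

variable {M C : Finset (Sym2 V)} {a b u v : V} {U : Type*} [Fintype U] {j : V ↪ U} {r : U}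

omit [Fintype V] in
/-- threshold bookkeeping for the deleted root. [folklore] -/
theorem apexDel_le_iff₀ {e l n K : ℤ} (h : e = l + 2 * n) : e - 2 * n ≤ K ↔ (0 : ℤ) ≤ K - l := by omega
omit [Fintype V] in
/-- threshold bookkeeping for the deleted root (state 1). [folklore] -/
theorem apexDel_le_iff₁ {e l n K : ℤ} (l0 : ℤ) (h : e = l + 2 * n) : e - 2 * n ≤ K ↔ l - l0 ≤ K - l0 := by omega

/-- **A2 for a real box, along an embedding with a fresh apex**: `0 ≤ Σ_β h(β)([L⁰ ≤ K] − [L¹ ≤ K])` for monotone `h` —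
`FK.theta_U_pivot` on the apex host with the apex path deleted. [cite: Grimmett2006, §3.8 Thm. (3.90) (pp. 61–62)] -/
theorem realBox_A2_apex (hr : r ∉ Set.range j) {B : Finset (Sym2 V)} (hB : IsTTSP B a b) (hy : s(u, v) ∈ B)
    (hM : M ⊆ B.erase s(u, v)) (hC : C ⊆ B.erase s(u, v)) {h : ↥M.powerset → ℝ} (mh : Monotone h) (K : ℤ) :
    0 ≤ ∑ β, h β * BaseSer.gA2 (realBox M C a b s(u, v) β) K := by
  have hyM : s(u, v) ∉ M := fun h => (Finset.mem_erase.1 (hM h)).1 rfl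
  obtain ⟨N0, hN0⟩ : ∃ N0, Nat.card {x : U // x ∉ Set.range j} = N0 := ⟨_, rfl⟩
  have hE := isTTSP_map_apex_reroot hB hr hy
  have hzM : s(j u, j v) ∉ M.map j.sym2Map := by rw [← sym2Map_mk, Finset.mem_map']; exact hyM
  have key := theta_U_pivot hE (map_subset_apexHost hM) (map_subset_apexHost (j := j) (r := r) (a := a) (b := b) hC) hzM
    (W := fun n => if (n : ℤ) - 2 * N0 ≤ K then (1 : ℝ) else 0)
    (fun n => by
      split_ifs with h1 h2
      · exact le_rfl
      · push_cast at h1; omega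
      · exact zero_le_one
      · exact le_rfl)
    (H := fun X' => h ⟨(Finset.univ.filter fun e : Sym2 V => j.sym2Map e ∈ X') ∩ M, Finset.mem_powerset.2 Finset.inter_subset_right⟩)
    (fun X' Y' hXY _ => pullWeight_mono mh hXY)
    (fun X' => by
      show h ⟨_, _⟩ = h ⟨_, _⟩
      congr 1
      apply Subtype.ext
      dsimp only
      rw [← sym2Map_mk, pull_insert_map, Finset.insert_inter_of_notMem hyM]) 0
  rw [show insert s(j u, j v) (M.map j.sym2Map) = (insert s(u, v) M).map j.sym2Map by rw [Finset.map_insert, sym2Map_mk],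
    ← sum_powerset_map, Finset.sum_powerset_insert hyM, ← Finset.sum_add_distrib, ← Finset.sum_coe_sort] at key
  refine key.trans_eq (Finset.sum_congr rfl fun β _ => ?_)
  rw [pullWeight_map h β, pullWeight_map_insert hyM h β]
  have k0 := apExpC_map j (insert s(u, v) M) C β.1
  have k1 := apExpC_map j (insert s(u, v) M) C (insert s(u, v) β.1)
  rw [hN0] at k0 k1
  have n0 : s(j u, j v) ∉ β.1.map j.sym2Map := by
    rw [← sym2Map_mk, Finset.mem_map']; exact fun h => hyM (Finset.mem_powerset.1 β.2 h)
  have n1 : s(j u, j v) ∈ (insert s(u, v) β.1).map j.sym2Map := by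
    rw [← sym2Map_mk, Finset.mem_map']; exact Finset.mem_insert_self _ _
  simp only [n0, n1, if_true, if_false, add_zero]
  obtain ⟨X, hX⟩ := β
  simp only [realBox, realSDat, BaseSer.gA2, Base.BDat.type, Cert.A2, Cert.I]
  zify at k0 k1
  simp only [apexDel_le_iff₀ k0, apexDel_le_iff₁ (apExpC (insert s(u, v) M) C X : ℤ) k1]
  push_cast
  ring

/-- **A2 for a real box.** [cite: Grimmett2006, §3.8 Thm. (3.90) (pp. 61–62)] -/
theorem realBox_A2 {B : Finset (Sym2 V)} (hB : IsTTSP B a b) (hy : s(u, v) ∈ B) (hM : M ⊆ B.erase s(u, v)) (hC : C ⊆ B.erase s(u, v))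
    {h : ↥M.powerset → ℝ} (mh : Monotone h) (K : ℤ) : 0 ≤ ∑ β, h β * BaseSer.gA2 (realBox M C a b s(u, v) β) K :=
  realBox_A2_apex none_notMem_range_some hB hy hM hC mh K

end A2

section SerPair

variable {B B' : Finset (Sym2 V)} {a m b uy vy uz vz : V} {My Cy Mz Cz : Finset (Sym2 V)}

/-- **Series gluing of two one-special boxes at the level of data.** [cite: Grimmett2006, §3.8 (pp. 61–62)] -/
theorem combS_realSDat (hd : Disjoint B B') (hV : ∀ w : V, (∃ e ∈ B, w ∈ e) → (∃ e ∈ B', w ∈ e) → w = m)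
    (haB' : ∀ e ∈ B', a ∉ e) (hbB : ∀ e ∈ B, b ∉ e) (ham : a ≠ m) (hbm : b ≠ m) (hab : a ≠ b)
    (hMy : insert s(uy, vy) My ⊆ B) (hCy : Cy ⊆ B) (hMz : insert s(uz, vz) Mz ⊆ B') (hCz : Cz ⊆ B')
    {Xy Xz : Finset (Sym2 V)} (hXy : Xy ⊆ insert s(uy, vy) My) (hXz : Xz ⊆ insert s(uz, vz) Mz) {X : Finset (Sym2 V)} (hX : X = Xy ∪ Xz) :
    BaseSer.combS (realSDat My Cy a m s(uy, vy) Xy) (realSDat Mz Cz m b s(uz, vz) Xz) =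
      ⟨(realPDat (My ∪ Mz) (Cy ∪ Cz) a b s(uy, vy) s(uz, vz) X).lam + 2 * Fintype.card V,
        (realPDat (My ∪ Mz) (Cy ∪ Cz) a b s(uy, vy) s(uz, vz) X).k1, (realPDat (My ∪ Mz) (Cy ∪ Cz) a b s(uy, vy) s(uz, vz) X).k2⟩ := by
  subst hX
  have g₁ : ∀ e ∈ (↑B : Set (Sym2 V)), ∀ w ∈ e, w ∈ {w : V | ∃ e ∈ B, w ∈ e} := fun e he w hw => ⟨e, he, hw⟩
  have g₂ : ∀ e ∈ (↑B' : Set (Sym2 V)), ∀ w ∈ e, w ∈ {w : V | ∃ e ∈ B', w ∈ e} := fun e he w hw => ⟨e, he, hw⟩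
  have gS : {w : V | ∃ e ∈ B, w ∈ e} ∩ {w : V | ∃ e ∈ B', w ∈ e} ⊆ ({m} : Set V) := fun w hw => hV w hw.1 hw.2
  have haV : a ∉ {w : V | ∃ e ∈ B', w ∈ e} := fun ⟨e, he, hae⟩ => haB' e he hae
  have hbV : b ∉ {w : V | ∃ e ∈ B, w ∈ e} := fun ⟨e, he, hbe⟩ => hbB e he hbe
  have hM : insert s(uy, vy) My ∪ insert s(uz, vz) Mz = insert s(uy, vy) (insert s(uz, vz) (My ∪ Mz)) := by
    rw [Finset.insert_union, Finset.union_insert]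
  have k := apExpC_series hd g₁ g₂ gS hMy hMz hCy hCz hXy hXz
  have r1 := reachable_union_series g₁ g₂ gS haV hbV ham hbm hab (Finset.union_subset (hXy.trans hMy) hCy)
    (Finset.union_subset (hXz.trans hMz) hCz)
  have r2 := reachable_union_series g₁ g₂ gS haV hbV ham hbm hab (γ₁ := insert s(uy, vy) My \ Xy ∪ Cy)
    (γ₂ := insert s(uz, vz) Mz \ Xz ∪ Cz)
    (Finset.union_subset (Finset.sdiff_subset.trans hMy) hCy) (Finset.union_subset (Finset.sdiff_subset.trans hMz) hCz)
  have hdM : Disjoint (insert s(uy, vy) My) (insert s(uz, vz) Mz) :=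
    Finset.disjoint_of_subset_left hMy (Finset.disjoint_of_subset_right hMz hd)
  have e1 : Xy ∪ Xz ∪ (Cy ∪ Cz) = Xy ∪ Cy ∪ (Xz ∪ Cz) := Finset.union_union_union_comm _ _ _ _
  have e2 : insert s(uy, vy) (insert s(uz, vz) (My ∪ Mz)) \ (Xy ∪ Xz) ∪ (Cy ∪ Cz) =
      insert s(uy, vy) My \ Xy ∪ Cy ∪ (insert s(uz, vz) Mz \ Xz ∪ Cz) := by
    rw [← hM, union_sdiff_union hdM hXy hXz, Finset.union_union_union_comm]
  rw [hM] at k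
  simp only [BaseSer.combS, PDat.mk.injEq]
  refine ⟨?_, ?_, ?_⟩
  · have k' := congrArg (Nat.cast : ℕ → ℤ) k
    simp only [Nat.cast_add, Nat.cast_mul, Nat.cast_ofNat] at k'
    simp only [realPDat, realSDat]
    linarith
  · simp only [realPDat, realSDat, reachB, e1]
    rw [Bool.eq_iff_iff]
    simp only [Bool.and_eq_true, decide_eq_true_eq]
    exact r1.symm
  · simp only [realPDat, realSDat, reachB, e2]
    rw [Bool.eq_iff_iff]
    simp only [Bool.and_eq_true, decide_eq_true_eq]
    exact r2.symm

/-- **The five facts for the real environment of a series pair** `B_y · B_z` (Δ-side base). [cite: Grimmett2006, §3.8 Thm. (3.90) (pp. 61–62)]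
[cite: Wagner2006, Thm. 5.8(d), §5.3] -/
theorem realSerPairEnv_facts (hB : IsTTSP B a m) (hB' : IsTTSP B' m b) (hd : Disjoint B B')
    (hV : ∀ w : V, (∃ e ∈ B, w ∈ e) → (∃ e ∈ B', w ∈ e) → w = m) (haB' : ∀ e ∈ B', a ∉ e) (hbB : ∀ e ∈ B, b ∉ e)
    (hy : s(uy, vy) ∈ B) (hz : s(uz, vz) ∈ B')
    (hMy : My ⊆ B.erase s(uy, vy)) (hCy : Cy ⊆ B.erase s(uy, vy)) (hMz : Mz ⊆ B'.erase s(uz, vz)) (hCz : Cz ⊆ B'.erase s(uz, vz))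
    (hMCy : Disjoint My Cy) (hMCz : Disjoint Mz Cz) :
    (∀ h0 h1 : ↥(My ∪ Mz).powerset → ℝ, Monotone h0 → Monotone h1 → (∀ γ, 0 ≤ h0 γ) → (∀ γ, h0 γ ≤ h1 γ) → ∀ J : ℤ,
        0 ≤ Mt (realEnv (My ∪ Mz) (Cy ∪ Cz) a b s(uy, vy) s(uz, vz)) h0 h1 J)
      ∧ (∀ h0 h1 : Bool × ↥(My ∪ Mz).powerset → ℝ, Monotone h0 → Monotone h1 → (∀ p, 0 ≤ h0 p) → (∀ p, h0 p ≤ h1 p) → ∀ J : ℤ,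
        0 ≤ Mt (parE (realEnv (My ∪ Mz) (Cy ∪ Cz) a b s(uy, vy) s(uz, vz))) h0 h1 J)
      ∧ (∀ h : ↥(My ∪ Mz).powerset → ℝ, Monotone h → (∀ γ, 0 ≤ h γ) → ∀ J : ℤ,
        0 ≤ ∑ γ, h γ * (realEnv (My ∪ Mz) (Cy ∪ Cz) a b s(uy, vy) s(uz, vz) γ).andDel J)
      ∧ (∀ h : ↥(My ∪ Mz).powerset → ℝ, Monotone h → (∀ γ, 0 ≤ h γ) → ∀ J : ℤ,
        0 ≤ ∑ γ, h γ * (realEnv (My ∪ Mz) (Cy ∪ Cz) a b s(uy, vy) s(uz, vz) γ).andCon J)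
      ∧ (∀ h0 h1 : ↥(My ∪ Mz).powerset → ℝ, Monotone h0 → Monotone h1 → (∀ γ, 0 ≤ h0 γ) → (∀ γ, h0 γ ≤ h1 γ) → ∀ J : ℤ,
          0 ≤ ∑ γ, (h1 γ * (realEnv (My ∪ Mz) (Cy ∪ Cz) a b s(uy, vy) s(uz, vz) γ).andE1 J +
            h0 γ * (realEnv (My ∪ Mz) (Cy ∪ Cz) a b s(uy, vy) s(uz, vz) γ).andE2 J)) := by
  have ham : a ≠ m := hB.ne
  have hbm : b ≠ m := hB'.ne.symm
  have hab : a ≠ b := by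
    obtain ⟨e, he, hae⟩ := hB.left_mem; exact fun h => hbB e he (h ▸ hae)
  have hMyB : My ⊆ B := hMy.trans (Finset.erase_subset _ _)
  have hMzB : Mz ⊆ B' := hMz.trans (Finset.erase_subset _ _)
  have hCyB : Cy ⊆ B := hCy.trans (Finset.erase_subset _ _)
  have hCzB : Cz ⊆ B' := hCz.trans (Finset.erase_subset _ _)
  have hdM : Disjoint My Mz := Finset.disjoint_of_subset_left hMyB (Finset.disjoint_of_subset_right hMzB hd)
  have hyM : s(uy, vy) ∉ My := fun h => (Finset.mem_erase.1 (hMy h)).1 rfl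
  have hzM : s(uz, vz) ∉ Mz := fun h => (Finset.mem_erase.1 (hMz h)).1 rfl
  have hyB' : s(uy, vy) ∉ B' := Finset.disjoint_left.1 hd hy
  have hzB : s(uz, vz) ∉ B := Finset.disjoint_right.1 hd hz
  have hyz : s(uy, vy) ≠ s(uz, vz) := fun h => hyB' (h ▸ hz)
  -- the glued host
  have hF : IsTTSP (B ∪ B') a b := IsTTSP.series hB hB' hd hV haB' hbB
  have hyF : s(uy, vy) ∈ B ∪ B' := Finset.mem_union_left _ hy
  have hzF : s(uz, vz) ∈ B ∪ B' := Finset.mem_union_right _ hz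
  have hME : My ∪ Mz ⊆ ((B ∪ B').erase s(uy, vy)).erase s(uz, vz) := fun e he => by
    rcases Finset.mem_union.1 he with h | h
    · exact Finset.mem_erase.2 ⟨fun h' => hzB (h' ▸ hMyB h), Finset.mem_erase.2 ⟨fun h' => hyM (h' ▸ h), Finset.mem_union_left _ (hMyB h)⟩⟩
    · exact Finset.mem_erase.2 ⟨fun h' => hzM (h' ▸ h), Finset.mem_erase.2 ⟨fun h' => hyB' (h' ▸ hMzB h), Finset.mem_union_right _ (hMzB h)⟩⟩
  have hCE : Cy ∪ Cz ⊆ ((B ∪ B').erase s(uy, vy)).erase s(uz, vz) := fun e he => by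
    rcases Finset.mem_union.1 he with h | h
    · exact Finset.mem_erase.2 ⟨fun h' => hzB (h' ▸ hCyB h), Finset.mem_erase.2
        ⟨fun h' => (Finset.mem_erase.1 (hCy h)).1 h', Finset.mem_union_left _ (hCyB h)⟩⟩
    · exact Finset.mem_erase.2 ⟨fun h' => (Finset.mem_erase.1 (hCz h)).1 h', Finset.mem_erase.2
        ⟨fun h' => hyB' (h' ▸ hCzB h), Finset.mem_union_right _ (hCzB h)⟩⟩
  have hMC : Disjoint (My ∪ Mz) (Cy ∪ Cz) := by
    rw [Finset.disjoint_union_left, Finset.disjoint_union_right, Finset.disjoint_union_right]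
    exact ⟨⟨hMCy, Finset.disjoint_of_subset_left hMyB (Finset.disjoint_of_subset_right hCzB hd)⟩,
      ⟨Finset.disjoint_of_subset_left hMzB (Finset.disjoint_of_subset_right hCyB hd.symm), hMCz⟩⟩
  have f3 : ∀ h : ↥(My ∪ Mz).powerset → ℝ, Monotone h → (∀ γ, 0 ≤ h γ) → ∀ J : ℤ,
      0 ≤ ∑ γ, h γ * (realEnv (My ∪ Mz) (Cy ∪ Cz) a b s(uy, vy) s(uz, vz) γ).andDel J :=
    fun h mh _ J => realEnv_andDel_nonneg hF hyF hzF hyz hME hCE hMC mh J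
  have f4 : ∀ h : ↥(My ∪ Mz).powerset → ℝ, Monotone h → (∀ γ, 0 ≤ h γ) → ∀ J : ℤ,
      0 ≤ ∑ γ, h γ * (realEnv (My ∪ Mz) (Cy ∪ Cz) a b s(uy, vy) s(uz, vz) γ).andCon J :=
    fun h mh _ J => realEnv_andCon_nonneg hF hyF hzF hyz hME hCE hMC mh J
  have f5 : ∀ h0 h1 : ↥(My ∪ Mz).powerset → ℝ, Monotone h0 → Monotone h1 → (∀ γ, 0 ≤ h0 γ) → (∀ γ, h0 γ ≤ h1 γ) → ∀ J : ℤ,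
      0 ≤ ∑ γ, (h1 γ * (realEnv (My ∪ Mz) (Cy ∪ Cz) a b s(uy, vy) s(uz, vz) γ).andE1 J +
        h0 γ * (realEnv (My ∪ Mz) (Cy ∪ Cz) a b s(uy, vy) s(uz, vz) γ).andE2 J) :=
    fun h0 h1 m0 m1 _ le J => realEnv_andFree_nonneg hF hyF hzF hyz hME hCE hMC m0 m1 le J
  -- the union equivalence and the data identity
  let φ : ↥My.powerset × ↥Mz.powerset ≃ ↥(My ∪ Mz).powerset :=
    { toFun := fun p => ⟨p.1.1 ∪ p.2.1, Finset.mem_powerset.2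
        (Finset.union_subset_union (Finset.mem_powerset.1 p.1.2) (Finset.mem_powerset.1 p.2.2))⟩
      invFun := fun δ => (⟨δ.1 ∩ My, Finset.mem_powerset.2 Finset.inter_subset_right⟩,
        ⟨δ.1 ∩ Mz, Finset.mem_powerset.2 Finset.inter_subset_right⟩)
      left_inv := fun p => by
        obtain ⟨⟨X, hX⟩, ⟨Y, hY⟩⟩ := p
        have hX' := Finset.mem_powerset.1 hX; have hY' := Finset.mem_powerset.1 hY
        refine Prod.ext (Subtype.ext ?_) (Subtype.ext ?_)
        · show (X ∪ Y) ∩ My = X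
          rw [Finset.union_inter_distrib_right, Finset.inter_eq_left.2 hX',
            Finset.disjoint_iff_inter_eq_empty.1 (Finset.disjoint_of_subset_left hY' hdM.symm), Finset.union_empty]
        · show (X ∪ Y) ∩ Mz = Y
          rw [Finset.union_inter_distrib_right, Finset.inter_eq_left.2 hY',
            Finset.disjoint_iff_inter_eq_empty.1 (Finset.disjoint_of_subset_left hX' hdM), Finset.empty_union]
      right_inv := fun δ => Subtype.ext (by
        show δ.1 ∩ My ∪ δ.1 ∩ Mz = δ.1
        rw [← Finset.inter_union_distrib_left, Finset.inter_eq_left.2 (Finset.mem_powerset.1 δ.2)]) }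
  have hφ : Monotone φ := fun p q hpq => show (φ p).1 ⊆ (φ q).1 from Finset.union_subset_union hpq.1 hpq.2
  have hφs : Monotone φ.symm := fun δ δ' hle =>
    Prod.mk_le_mk.2 ⟨show δ.1 ∩ My ⊆ δ'.1 ∩ My from Finset.inter_subset_inter hle le_rfl,
      show δ.1 ∩ Mz ⊆ δ'.1 ∩ Mz from Finset.inter_subset_inter hle le_rfl⟩
  have hMy' : insert s(uy, vy) My ⊆ B := Finset.insert_subset hy hMyB
  have hMz' : insert s(uz, vz) Mz ⊆ B' := Finset.insert_subset hz hMzB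
  have hd' : ∀ p : ↥My.powerset × ↥Mz.powerset, realEnv (My ∪ Mz) (Cy ∪ Cz) a b s(uy, vy) s(uz, vz) (φ p) =
      ⟨⟨(BaseSer.serPair (realBox My Cy a m s(uy, vy)) (realBox Mz Cz m b s(uz, vz)) p).d0.lam + (-(2 * (Fintype.card V : ℤ))),
          (BaseSer.serPair (realBox My Cy a m s(uy, vy)) (realBox Mz Cz m b s(uz, vz)) p).d0.k1,
          (BaseSer.serPair (realBox My Cy a m s(uy, vy)) (realBox Mz Cz m b s(uz, vz)) p).d0.k2⟩,
        ⟨(BaseSer.serPair (realBox My Cy a m s(uy, vy)) (realBox Mz Cz m b s(uz, vz)) p).dy.lam + (-(2 * (Fintype.card V : ℤ))),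
          (BaseSer.serPair (realBox My Cy a m s(uy, vy)) (realBox Mz Cz m b s(uz, vz)) p).dy.k1,
          (BaseSer.serPair (realBox My Cy a m s(uy, vy)) (realBox Mz Cz m b s(uz, vz)) p).dy.k2⟩,
        ⟨(BaseSer.serPair (realBox My Cy a m s(uy, vy)) (realBox Mz Cz m b s(uz, vz)) p).dz.lam + (-(2 * (Fintype.card V : ℤ))),
          (BaseSer.serPair (realBox My Cy a m s(uy, vy)) (realBox Mz Cz m b s(uz, vz)) p).dz.k1,
          (BaseSer.serPair (realBox My Cy a m s(uy, vy)) (realBox Mz Cz m b s(uz, vz)) p).dz.k2⟩,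
        ⟨(BaseSer.serPair (realBox My Cy a m s(uy, vy)) (realBox Mz Cz m b s(uz, vz)) p).dyz.lam + (-(2 * (Fintype.card V : ℤ))),
          (BaseSer.serPair (realBox My Cy a m s(uy, vy)) (realBox Mz Cz m b s(uz, vz)) p).dyz.k1,
          (BaseSer.serPair (realBox My Cy a m s(uy, vy)) (realBox Mz Cz m b s(uz, vz)) p).dyz.k2⟩⟩ := by
    rintro ⟨β, γ⟩
    have b0 : β.1 ⊆ insert s(uy, vy) My := (Finset.mem_powerset.1 β.2).trans (Finset.subset_insert _ _)
    have b1 : insert s(uy, vy) β.1 ⊆ insert s(uy, vy) My := Finset.insert_subset_insert _ (Finset.mem_powerset.1 β.2)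
    have c0 : γ.1 ⊆ insert s(uz, vz) Mz := (Finset.mem_powerset.1 γ.2).trans (Finset.subset_insert _ _)
    have c1 : insert s(uz, vz) γ.1 ⊆ insert s(uz, vz) Mz := Finset.insert_subset_insert _ (Finset.mem_powerset.1 γ.2)
    have e0 := PDat.eq_of_addLam (combS_realSDat hd hV haB' hbB ham hbm hab hMy' hCyB hMz' hCzB b0 c0 (rfl : β.1 ∪ γ.1 = _))
    have ey := PDat.eq_of_addLam (combS_realSDat hd hV haB' hbB ham hbm hab hMy' hCyB hMz' hCzB b1 c0 (Finset.insert_union _ _ _).symm)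
    have ez := PDat.eq_of_addLam (combS_realSDat hd hV haB' hbB ham hbm hab hMy' hCyB hMz' hCzB b0 c1 (Finset.union_insert _ _ _).symm)
    have eyz := PDat.eq_of_addLam (combS_realSDat hd hV haB' hbB ham hbm hab hMy' hCyB hMz' hCzB b1 c1
      (by rw [Finset.insert_union, Finset.union_insert]))
    show (⟨realPDat _ _ a b _ _ (β.1 ∪ γ.1), realPDat _ _ a b _ _ (insert s(uy, vy) (β.1 ∪ γ.1)),
      realPDat _ _ a b _ _ (insert s(uz, vz) (β.1 ∪ γ.1)), realPDat _ _ a b _ _ (insert s(uy, vy) (insert s(uz, vz) (β.1 ∪ γ.1)))⟩ : EDat) = _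
    rw [e0, ey, ez, eyz]
    rfl
  -- the contracted AND of the abstract series pair, pulled back from the real one
  have hCon : ∀ h : ↥My.powerset × ↥Mz.powerset → ℝ, Monotone h → (∀ p, 0 ≤ h p) → ∀ K : ℤ,
      0 ≤ ∑ p, h p * (BaseSer.serPair (realBox My Cy a m s(uy, vy)) (realBox Mz Cz m b s(uz, vz)) p).andCon K := by
    intro h mh nh K
    refine transfer_single (E := realEnv (My ∪ Mz) (Cy ∪ Cz) a b s(uy, vy) s(uz, vz)) (φ := φ.symm) (κ := 2 * (Fintype.card V : ℤ))
      (I := fun e J => e.andCon J) hφs (fun δ J => ?_) f4 h mh nh K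
    have h4 := (transfer_hs hd' (φ.symm δ) (J - 2 * (Fintype.card V : ℤ))).2.2.2.1
    rw [Equiv.apply_symm_apply] at h4
    rw [h4]; congr 1; ring
  refine ⟨?_, ?_, f3, f4, f5⟩
  · exact fun H0 H1 m0 m1 n0 le J => transfer_Mt hφ (fun p J => ⟨(transfer_hs hd' p J).1, (transfer_hs hd' p J).2.1⟩)
      (fun h0 h1 m0' m1' n0' le' J' => BaseSer.serPair_Mt_nonneg _ _ (fun β => realBox_consistent hyM β) (fun γ => realBox_consistent hzM γ)
        (fun _ mh _ K => realBox_A2 hB hy hMy hCy mh K) (fun _ _ m0'' m1'' _ le'' K => realBox_A3n hB hy hMy hCy m0'' m1'' le'' K)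
        (fun _ _ m0'' m1'' _ le'' K => realBox_A4n hB hy hMy hCy m0'' m1'' le'' K)
        (fun _ mh _ K => realBox_A2 hB' hz hMz hCz mh K) (fun _ _ m0'' m1'' _ le'' K => realBox_A3n hB' hz hMz hCz m0'' m1'' le'' K)
        (fun _ _ m0'' m1'' _ le'' K => realBox_A4n hB' hz hMz hCz m0'' m1'' le'' K) m0' m1' n0' le' J') H0 H1 m0 m1 n0 le J
  · refine fun H0 H1 m0 m1 n0 le J => transfer_parE hφ hd' (fun h0 h1 m0' m1' n0' le' J' => ?_) H0 H1 m0 m1 n0 le J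
    exact BasePar.serPair_parE_Mt_nonneg _ _ (fun β => realBox_consistent hyM β) (fun γ => realBox_consistent hzM γ)
      (fun _ mh _ K => realBox_A2 hB hy hMy hCy mh K) (fun _ _ m0'' m1'' _ le'' K => realBox_A3n hB hy hMy hCy m0'' m1'' le'' K)
      (fun _ _ m0'' m1'' _ le'' K => realBox_A4n hB hy hMy hCy m0'' m1'' le'' K)
      (fun _ mh _ K => realBox_A2 hB' hz hMz hCz mh K) (fun _ _ m0'' m1'' _ le'' K => realBox_A3n hB' hz hMz hCz m0'' m1'' le'' K)
      (fun _ _ m0'' m1'' _ le'' K => realBox_A4n hB' hz hMz hCz m0'' m1'' le'' K) hCon m0' m1' n0' le' J'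

end SerPair

end RootForm

end FK

end Summit.CriticalPhenomena.PercolationContinuityZ3.Theorems

end
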